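import Mathlib
import HarnessLib
import Summits.HubbardSuperconductivity.HubbardSuperconductivity.Theorems.KLProgrammePerturbedFermiCurveNormalAngleLevelGap

/-!
# Route `KLProgramme` — ENGINE child (stmt-HubbardSuperconductivity-20437 `KLRegimeEngineV17F2`): the COOPER ARC lemmas on the frame's Fermi curve —
# first-order Taylor of the translated level function in the transfer, and «zeros sit on arcs where the normal is ⊥ w»
# (inputs of the ≤ 3 intersection count of step (T2), frame analogue of p1b's `klcc_transLevel_taylor` / `klcc_abs_transLevel_le_on_arc`;
# design note HOME/hubbard-kl-k3c2-p2/TWO-SHELL-FRAME-PORT.md §6)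

Cell `gate-hubbard-kl`, seat hubbard-kl-k3c2-p2 g15.  Frame `δ_K = −K.eval` on `Fin 2 → ℝ`, `E = ε₀ + δ_K` (`= e_K ∘ toLp + μ`), `GeomConstants (frameLevel μ K) Kc r₀ g₀ w`
(only `‖D²e_K‖ ≤ Kc`, GLOBAL, is used here), a root selection `u` of the level-`ν` curve with C⁰/C¹ binders `κ₀`, `κ₁ < Dt_min`, normal angle `α`, radial factor
`Λ(θ) = ρ_r√S/u ∈ [Dt_min − κ₁, (4+κ₁)√2 S_E/u_min]`:
* §1 `abs_transLevel_taylor_le` — `|E(p − v) − E(p) + DE(p)[v]| ≤ Kc·(v₀² + v₁²)` for ALL `p, v` (segment mean-value with `‖De_K(x) − De_K(y)‖ ≤ Kc‖x − y‖`);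
* §2 on the curve: `DE(p(θ))[v] = Λ(θ)·(cos α·v₀ + sin α·v₁)` (`slopeForm_eq_radial_mul`), so
  `abs_transLevel_add_radial_le` — `|E(p(θ) − v) − ν + Λ(θ)·r·cos(α(θ) − ψ)| ≤ Kc·r²` for `v = r·(cos ψ, sin ψ)`;
  `abs_cos_normalAngle_sub_le_of_zero` — at an intersection point (`E(p(θ) − v) = ν`): `|cos(α(θ) − ψ)| ≤ Kc·r/(Dt_min − κ₁)` (the zero sits where the
  normal is `O(r)`-close to `⊥ v`);
  `abs_transLevel_le_on_arc` — on the arc `|α(θ) − ψ − π/2 − kπ| ≤ (π/2)s`: `|E(p(θ) − v) − ν| ≤ Λ_max·r·(π/2)s + Kc·r²`, `Λ_max = (4+κ₁)√2·S_E/u_min`.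
Everything is PROVED; no definitions, no named facts; nothing asserts any stub or superconductivity.
References: BGM 2006 §2.4 [cite: BenfattoGiulianiMastropietro2006]; FST II App. B, DECOMP App. E Lemma E.1 [cite: FeldmanSalmhoferTrubowitz1998].
-/

noncomputable section

namespace Summit.HubbardSuperconductivity.HubbardSuperconductivity.Theorems.PerturbedFermiCurve

set_option linter.dupNamespace false -- summit = problem name (single-conjunct summit), D-0017

open Real Set
open Literature.MathematicalPhysics.QuantumLattice Literature.MathematicalPhysics.QuantumLattice.BandSectorCounting
open Literature.MathematicalPhysics.QuantumLattice.FermiRG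
open Summit.HubbardSuperconductivity.HubbardSuperconductivity.Theorems.DispersionFlow
open Summit.HubbardSuperconductivity.HubbardSuperconductivity.Theorems.KLRegimeSplit

/-! ## §1 First-order Taylor of the frame dispersion in the transfer -/

/-- **`|E(p − v) − E(p) + DE(p)[v]| ≤ Kc·(v₀² + v₁²)`** for `E = ε₀ + δ_K` on `Fin 2 → ℝ`, from the GLOBAL bound `‖D²e_K‖ ≤ Kc` of `GeomConstants`
(mean value along the segment `t ↦ p − t·v` for `t ↦ E(p − tv) + t·DE(p)[v]`). [folklore] -/
theorem abs_transLevel_taylor_le {μ : ℝ} {K : TrigPolyC4v} {Kc r₀ g₀ w : ℝ} (hG : GeomConstants (frameLevel μ K) Kc r₀ g₀ w)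
    (p v : Fin 2 → ℝ) :
    |(sqDispersion (p - v) + -K.eval (p - v)) - (sqDispersion p + -K.eval p) +
        (2 * Real.sin (p 0) * v 0 + 2 * Real.sin (p 1) * v 1 + fderiv ℝ (fun k : Fin 2 → ℝ => -K.eval k) p v)| ≤
      Kc * (v 0 ^ 2 + v 1 ^ 2) := by
  -- everything through `e_K` on `Momentum`
  set f := frameLevel μ K with hf
  set P : Momentum := WithLp.toLp 2 p with hP
  set V : Momentum := WithLp.toLp 2 v with hV
  have hcd : ContDiff ℝ 2 f := by
    rw [hf, frameLevel_eq_add]; exact (klfs_contDiff_e μ).add (contDiff_frameShift K)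
  have hd1 : Differentiable ℝ f := hcd.differentiable (by norm_num)
  have hd2 : ContDiff ℝ 1 (fderiv ℝ f) := hcd.fderiv_right (by norm_num)
  have hEval : ∀ q : Fin 2 → ℝ, sqDispersion q + -K.eval q = f (WithLp.toLp 2 q) + μ := by
    intro q; rw [hf, frameLevel_toLp, frameShift_toLp]; ring
  have hDer : 2 * Real.sin (p 0) * v 0 + 2 * Real.sin (p 1) * v 1 + fderiv ℝ (fun k : Fin 2 → ℝ => -K.eval k) p v =
      fderiv ℝ f P V := by rw [hf, fderiv_frameLevel_toLp]
  have hPV : (WithLp.toLp 2 (p - v) : Momentum) = P - V := by rw [hP, hV, WithLp.toLp_sub]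
  rw [hEval, hEval, hPV, hDer]
  -- `g(t) = f(P − tV) + t·Df(P)[V]`, `g′(t) = −Df(P − tV)[V] + Df(P)[V]`, `|g′| ≤ Kc‖V‖²`
  have hseg : ∀ t : ℝ, HasDerivAt (fun s : ℝ => f (P - s • V) + s * fderiv ℝ f P V)
      (-(fderiv ℝ f (P - t • V) V) + fderiv ℝ f P V) t := by
    intro t
    have hl : HasDerivAt (fun s : ℝ => P - s • V) (-V) t := by
      simpa using ((hasDerivAt_id t).smul_const V).const_sub P
    have h1 : HasDerivAt (fun s : ℝ => f (P - s • V)) (fderiv ℝ f (P - t • V) (-V)) t :=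
      (hd1 _).hasFDerivAt.comp_hasDerivAt t hl
    have h2 : HasDerivAt (fun s : ℝ => s * fderiv ℝ f P V) (fderiv ℝ f P V) t := by
      simpa using (hasDerivAt_id t).mul_const (fderiv ℝ f P V)
    have h := h1.add h2
    rw [map_neg] at h
    exact h
  have hLip : ∀ t ∈ Ico (0 : ℝ) 1, ‖-(fderiv ℝ f (P - t • V) V) + fderiv ℝ f P V‖ ≤ Kc * (v 0 ^ 2 + v 1 ^ 2) := by
    intro t ht
    have hdiff' : ∀ x ∈ (Set.univ : Set Momentum), DifferentiableAt ℝ (fderiv ℝ f) x :=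
      fun x _ => (hd2.differentiable one_ne_zero) x
    have hbound : ∀ x ∈ (Set.univ : Set Momentum), ‖fderiv ℝ (fderiv ℝ f) x‖ ≤ Kc := by
      intro x _
      rw [← norm_iteratedFDeriv_one (𝕜 := ℝ) (f := fderiv ℝ f), norm_iteratedFDeriv_fderiv]
      exact hG.norm_iteratedFDeriv_le x 2 le_rfl
    have hmvt := convex_univ.norm_image_sub_le_of_norm_fderiv_le hdiff' hbound (Set.mem_univ (P - t • V)) (Set.mem_univ P)
    have hdist : ‖P - (P - t • V)‖ = |t| * ‖V‖ := by rw [sub_sub_cancel, norm_smul, Real.norm_eq_abs]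
    rw [hdist] at hmvt
    have hV2 : ‖V‖ ^ 2 = v 0 ^ 2 + v 1 ^ 2 := by
      rw [hV, EuclideanSpace.norm_eq, Real.sq_sqrt (Finset.sum_nonneg fun i _ => sq_nonneg _), Fin.sum_univ_two]
      simp only [Real.norm_eq_abs, sq_abs]
    have ht1 : |t| ≤ 1 := by rw [abs_of_nonneg ht.1]; exact ht.2.le
    have hKc : 0 ≤ Kc := le_trans (norm_nonneg _) (hG.norm_iteratedFDeriv_le P 0 (by norm_num))
    calc ‖-(fderiv ℝ f (P - t • V) V) + fderiv ℝ f P V‖ = ‖(fderiv ℝ f P - fderiv ℝ f (P - t • V)) V‖ := by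
          rw [sub_apply]; congr 1; abel
      _ ≤ ‖fderiv ℝ f P - fderiv ℝ f (P - t • V)‖ * ‖V‖ := ContinuousLinearMap.le_opNorm _ _
      _ ≤ Kc * (|t| * ‖V‖) * ‖V‖ := mul_le_mul_of_nonneg_right hmvt (norm_nonneg _)
      _ ≤ Kc * (1 * ‖V‖) * ‖V‖ := by gcongr
      _ = Kc * (v 0 ^ 2 + v 1 ^ 2) := by rw [one_mul, mul_assoc, ← sq, hV2]
  have hmain := norm_image_sub_le_of_norm_deriv_le_segment_01' (fun t _ => (hseg t).hasDerivWithinAt) hLip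
  simp only [one_smul, one_mul, zero_smul, sub_zero, zero_mul, add_zero] at hmain
  rw [Real.norm_eq_abs] at hmain
  have e : f (P - V) + μ - (f P + μ) + fderiv ℝ f P V = f (P - V) + fderiv ℝ f P V - f P := by ring
  rw [e]; exact hmain

/-! ## §2 On the curve: the radial form, zeros, arcs -/

section Root

variable {a b : ℝ} (B : BandBounds a b) {K : TrigPolyC4v} {κ₀ κ₁ ν : ℝ}
  (hδ : ∀ k : Fin 2 → ℝ, (∀ i, |k i| ≤ π) → |(fun k : Fin 2 → ℝ => -K.eval k) k| ≤ κ₀) (hlo : a ≤ ν - κ₀) (hhi : ν + κ₀ ≤ b)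
  (hκ : ∀ k : Fin 2 → ℝ, (∀ i, |k i| ≤ π) → ‖fderiv ℝ (fun k : Fin 2 → ℝ => -K.eval k) k‖ ≤ κ₁) (hκ₁ : κ₁ < B.Dtmin)
  {u : ℝ → ℝ} (hu : ∀ θ, IsBandFermiRadius (ν - (fun k : Fin 2 → ℝ => -K.eval k) (u θ • dir θ)) θ (u θ))
  {μ Kc r₀ g₀ w : ℝ} (hG : GeomConstants (frameLevel μ K) Kc r₀ g₀ w)
include B hδ hlo hhi hκ hκ₁ hu hG

/-- **Radial form of the translated level**: for `v = r·(cos ψ, sin ψ)`,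
`|E(p(θ) − v) − ν + Λ(θ)·r·cos(α(θ) − ψ)| ≤ Kc·r²`, `Λ(θ) = ρ_r(θ)√S(θ)/u(θ)`. [cite: BenfattoGiulianiMastropietro2006, §2.4] -/
theorem abs_transLevel_add_radial_le (θ r ψ : ℝ) :
    |(sqDispersion (u θ • dir θ - r • dir ψ) + -K.eval (u θ • dir θ - r • dir ψ)) - ν +
        (rayDispersionDt θ (u θ) + fderiv ℝ (fun k : Fin 2 → ℝ => -K.eval k) (u θ • dir θ) (dir θ)) *
          Real.sqrt (u θ ^ 2 + deriv u θ ^ 2) / u θ * (r * Real.cos ((θ - Real.arctan (deriv u θ / u θ)) - ψ))| ≤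
      Kc * r ^ 2 := by
  have hδs : ContDiff ℝ 2 (fun k : Fin 2 → ℝ => -K.eval k) := contDiff_frameShift_toLp K
  have h2ne : (2 : WithTop ℕ∞) ≠ 0 := by norm_num
  have hu2 : ContDiff ℝ 2 u := contDiff_of_isRoot B hδs h2ne hδ hlo hhi hκ hκ₁ hu
  have hroot : ∀ ϑ, sqDispersion (u ϑ • dir ϑ) + (fun k : Fin 2 → ℝ => -K.eval k) (u ϑ • dir ϑ) = ν := fun ϑ =>
    ((isBandFermiRadius_shifted_iff (fun k : Fin 2 → ℝ => -K.eval k) ν ϑ (u ϑ)).1 (hu ϑ)).2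
  have hpos : ∀ ϑ, 0 < u ϑ := fun ϑ => (mem_Ioo_of_shifted B hδ hlo hhi (hu ϑ)).1
  set p := u θ • dir θ with hp
  set v := r • dir ψ with hv
  have htaylor := abs_transLevel_taylor_le hG p v
  have hE : sqDispersion p + -K.eval p = ν := hroot θ
  have hp0 : p 0 = XE u θ := by simp [hp, XE, dir]
  have hp1 : p 1 = YE u θ := by simp [hp, YE, dir]
  have hv0 : v 0 = r * Real.cos ψ := by simp [hv, dir]
  have hv1 : v 1 = r * Real.sin ψ := by simp [hv, dir]
  have hrad := slopeForm_eq_radial_mul hδs hu2 hroot hpos θ v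
  rw [hE, hp0, hp1, hrad, hv0, hv1] at htaylor
  have hcs : (r * Real.cos ψ) ^ 2 + (r * Real.sin ψ) ^ 2 = r ^ 2 := by nlinarith [Real.cos_sq_add_sin_sq ψ]
  rw [hcs] at htaylor
  have e : Real.cos (θ - Real.arctan (deriv u θ / u θ)) * (r * Real.cos ψ) + Real.sin (θ - Real.arctan (deriv u θ / u θ)) * (r * Real.sin ψ) =
      r * Real.cos ((θ - Real.arctan (deriv u θ / u θ)) - ψ) := by
    rw [Real.cos_sub (θ - Real.arctan (deriv u θ / u θ)) ψ]; ring
  rw [e] at htaylor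
  exact htaylor

/-- **An intersection point sits where the normal is nearly `⊥` to the transfer**: if `E(p(θ) − r·dir ψ) = ν` (`r > 0`) then
`|cos(α(θ) − ψ)| ≤ Kc·r/(Dt_min − κ₁)`. [cite: FeldmanSalmhoferTrubowitz1998, App. B] -/
theorem abs_cos_normalAngle_sub_le_of_zero {θ r ψ : ℝ} (hr : 0 < r)
    (hzero : sqDispersion (u θ • dir θ - r • dir ψ) + -K.eval (u θ • dir θ - r • dir ψ) = ν) :
    |Real.cos ((θ - Real.arctan (deriv u θ / u θ)) - ψ)| ≤ Kc * r / (B.Dtmin - κ₁) := by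
  have h := abs_transLevel_add_radial_le B hδ hlo hhi hκ hκ₁ hu hG θ r ψ
  rw [hzero, sub_self, zero_add] at h
  set Λ := (rayDispersionDt θ (u θ) + fderiv ℝ (fun k : Fin 2 → ℝ => -K.eval k) (u θ • dir θ) (dir θ)) *
      Real.sqrt (u θ ^ 2 + deriv u θ ^ 2) / u θ with hΛ
  have hD : 0 < B.Dtmin - κ₁ := sub_pos.2 hκ₁
  have hρ := Dtmin_sub_le_pertDt B hδ hlo hhi hκ hu θ
  have hupos : 0 < u θ := (mem_Ioo_of_shifted B hδ hlo hhi (hu θ)).1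
  have hsu : 1 ≤ Real.sqrt (u θ ^ 2 + deriv u θ ^ 2) / u θ := by
    rw [le_div_iff₀ hupos, one_mul]
    calc u θ = Real.sqrt (u θ ^ 2) := (Real.sqrt_sq hupos.le).symm
      _ ≤ _ := Real.sqrt_le_sqrt (by nlinarith [sq_nonneg (deriv u θ)])
  have hΛge : B.Dtmin - κ₁ ≤ Λ := by
    rw [hΛ, mul_div_assoc]
    calc B.Dtmin - κ₁ = (B.Dtmin - κ₁) * 1 := (mul_one _).symm
      _ ≤ _ := mul_le_mul hρ hsu zero_le_one (hD.le.trans hρ)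
  have hΛpos : 0 < Λ := hD.trans_le hΛge
  -- `Λ r |cos| ≤ Kc r²`
  rw [abs_mul, abs_of_pos hΛpos, abs_mul, abs_of_pos hr] at h
  rw [le_div_iff₀ hD]
  have h1 : |Real.cos (θ - Real.arctan (deriv u θ / u θ) - ψ)| * (B.Dtmin - κ₁) ≤ |Real.cos (θ - Real.arctan (deriv u θ / u θ) - ψ)| * Λ :=
    mul_le_mul_of_nonneg_left hΛge (abs_nonneg _)
  have h2 : Λ * (r * |Real.cos (θ - Real.arctan (deriv u θ / u θ) - ψ)|) ≤ Kc * r ^ 2 := h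
  nlinarith [h1, h2, abs_nonneg (Real.cos (θ - Real.arctan (deriv u θ / u θ) - ψ)), hr]

/-- **On an arc where the normal angle is within `(π/2)s` of `ψ + π/2 + kπ` the translated level is small**:
`|E(p(θ) − r·dir ψ) − ν| ≤ (4 + κ₁)·√2·S_E/u_min · r·(π/2)s + Kc·r²` (`S_E = s_max + κ₁(π√2 + 2s_max)/(Dt_min − κ₁)`).
[cite: FeldmanSalmhoferTrubowitz1998, App. B] -/
theorem abs_transLevel_le_on_arc {θ r ψ s : ℝ} {k : ℤ} (hr : 0 ≤ r)
    (harc : |(θ - Real.arctan (deriv u θ / u θ)) - ψ - π / 2 - k * π| ≤ π / 2 * s) :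
    |(sqDispersion (u θ • dir θ - r • dir ψ) + -K.eval (u θ • dir θ - r • dir ψ)) - ν| ≤
      (4 + κ₁) * (Real.sqrt 2 * (B.smax + κ₁ * (π * Real.sqrt 2 + 2 * B.smax) / (B.Dtmin - κ₁))) / B.umin * (r * (π / 2 * s)) +
        Kc * r ^ 2 := by
  have hδs : ContDiff ℝ 2 (fun k : Fin 2 → ℝ => -K.eval k) := contDiff_frameShift_toLp K
  have h2ne : (2 : WithTop ℕ∞) ≠ 0 := by norm_num
  have h := abs_transLevel_add_radial_le B hδ hlo hhi hκ hκ₁ hu hG θ r ψ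
  set Λ := (rayDispersionDt θ (u θ) + fderiv ℝ (fun k : Fin 2 → ℝ => -K.eval k) (u θ • dir θ) (dir θ)) *
      Real.sqrt (u θ ^ 2 + deriv u θ ^ 2) / u θ with hΛ
  set α := θ - Real.arctan (deriv u θ / u θ) with hα
  set SE := B.smax + κ₁ * (π * Real.sqrt 2 + 2 * B.smax) / (B.Dtmin - κ₁) with hSE
  have hsq := abs_apply_le_pi_of_isBandFermiRadius (hu θ)
  have hκ₁0 : 0 ≤ κ₁ := le_trans (norm_nonneg _) (hκ _ hsq)
  have hD : 0 < B.Dtmin - κ₁ := sub_pos.2 hκ₁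
  have hupos : 0 < u θ := (mem_Ioo_of_shifted B hδ hlo hhi (hu θ)).1
  have humin : B.umin ≤ u θ := umin_le_of_shifted B hδ hlo hhi (hu θ)
  have hum0 := B.umin_pos
  -- `0 < ρ_r ≤ 4 + κ₁`, `√S ≤ √2·S_E`
  have hρpos := pertDt_pos B hδ hlo hhi hκ hκ₁ hu θ
  have hρle : rayDispersionDt θ (u θ) + fderiv ℝ (fun k : Fin 2 → ℝ => -K.eval k) (u θ • dir θ) (dir θ) ≤ 4 + κ₁ := by
    have h1 := (abs_le.1 (abs_rayDispersionDt_le_four θ (u θ))).2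
    have h2 := (abs_le.1 (abs_fderiv_dir_le (hκ _ hsq) θ)).2
    linarith
  have hS := deriv_sq_add_sq_le B hδs hδ hlo hhi hκ hκ₁ hu θ
  have hSE0 : 0 ≤ SE := by
    obtain ⟨hvx, -⟩ := abs_VXE_le B hδs h2ne hδ hlo hhi hκ hκ₁ hu θ
    exact (abs_nonneg _).trans hvx
  have hsqrtS : Real.sqrt (u θ ^ 2 + deriv u θ ^ 2) ≤ Real.sqrt 2 * SE := by
    rw [← Real.sqrt_sq hSE0, ← Real.sqrt_mul (by norm_num : (0:ℝ) ≤ 2)]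
    exact Real.sqrt_le_sqrt (by nlinarith)
  have hΛle : Λ ≤ (4 + κ₁) * (Real.sqrt 2 * SE) / B.umin := by
    rw [hΛ, div_le_div_iff₀ hupos hum0]
    have hnum : (rayDispersionDt θ (u θ) + fderiv ℝ (fun k : Fin 2 → ℝ => -K.eval k) (u θ • dir θ) (dir θ)) *
        Real.sqrt (u θ ^ 2 + deriv u θ ^ 2) ≤ (4 + κ₁) * (Real.sqrt 2 * SE) :=
      mul_le_mul hρle hsqrtS (Real.sqrt_nonneg _) (by linarith)
    have h0 : 0 ≤ (4 + κ₁) * (Real.sqrt 2 * SE) := by positivity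
    calc _ ≤ (4 + κ₁) * (Real.sqrt 2 * SE) * B.umin := mul_le_mul_of_nonneg_right hnum hum0.le
      _ ≤ (4 + κ₁) * (Real.sqrt 2 * SE) * u θ := mul_le_mul_of_nonneg_left humin h0
  have hΛpos : 0 < Λ := by rw [hΛ]; positivity
  -- `|cos(α − ψ)| ≤ (π/2) s`
  have hcos : |Real.cos (α - ψ)| ≤ π / 2 * s := by
    set t := α - ψ - π / 2 - k * π with ht
    have e : α - ψ = t + π / 2 + k * π := by rw [ht]; ring
    rw [e, Real.cos_add_int_mul_pi, Real.cos_add_pi_div_two, abs_mul, klcc_abs_neg_one_zpow, one_mul, abs_neg]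
    calc |Real.sin t| = |Real.sin t - Real.sin 0| := by rw [Real.sin_zero, sub_zero]
      _ ≤ |t - 0| := Real.abs_sin_sub_sin_le _ _
      _ = |t| := by rw [sub_zero]
      _ ≤ π / 2 * s := harc
  have hterm : |Λ * (r * Real.cos (α - ψ))| ≤ (4 + κ₁) * (Real.sqrt 2 * SE) / B.umin * (r * (π / 2 * s)) := by
    rw [abs_mul, abs_of_pos hΛpos, abs_mul, abs_of_nonneg hr]
    exact mul_le_mul hΛle (mul_le_mul_of_nonneg_left hcos hr) (by positivity) (by positivity)
  have htri := abs_sub_abs_le_abs_sub ((sqDispersion (u θ • dir θ - r • dir ψ) + -K.eval (u θ • dir θ - r • dir ψ)) - ν)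
    (-(Λ * (r * Real.cos (α - ψ))))
  rw [abs_neg, sub_neg_eq_add] at htri
  linarith [htri, hterm, h]

end Root

end Summit.HubbardSuperconductivity.HubbardSuperconductivity.Theorems.PerturbedFermiCurve

end
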